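import Literature.AlgebraicGeometry.Resolution.CoefficientIdealRestriction
import Mathlib.NumberTheory.Bertrand
import HarnessLib

/-!
# The next level of the characteristic-zero induction has order `≥ m!`: the factorial threshold of the tame regime

Topic: `Literature/AlgebraicGeometry/Resolution`. In the characteristic-zero induction (Kollár
2007, 3.104 Step 2.2 / Cor. 3.85; Bierstone–Grigoriev–Milman–Włodarczyk 2011, §4 Step 2 with
Lemma 3.9.4) the marked ideal `(X, 𝓘, μ)` of maximal order `μ` is replaced, on a hypersurface of
maximal contact `S = V(H)`, by the restricted coefficient marked ideal
`𝒞(𝓘, μ)|_S = (S, 𝒞(𝓘)·𝒪_S, μ!)` (BGMW Def. 3.9.2; tree `MarkedIdeal.coeff`, marking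
`μ! = Π_{i<μ}(μ − i)`, `MarkedIdeal.coeff_mult`), and BGMW Lemma 3.9.4 (2) gives
`supp(𝒞(𝓘, μ)|_S) = S ∩ supp(𝓘, μ)` (tree `MarkedIdeal.support_coeff_comap_subschemeι(_of_smooth)`,
for `1, …, μ − 1` units). BGMW §8, Thm. 8.0.4: the algorithm runs in characteristic `p` "as long as
all multiplicities stay `< p`"; Kollár §2.5 (p. 81): maximal contact "enabled Abhyankar to prove
resolution of 3-dimensional varieties in characteristic `> 3!`".

This file records WHY the factorial enters the threshold — the first-level data of the induction
have order at least `μ!`: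

* `MarkedIdeal.factorial_le_idealOrder_coeff_comap` — at every point `s ∈ S` lying over
  `supp(𝓘, μ)`, **`ord_s (𝒞(𝓘)·𝒪_S) ≥ μ!`** (any `k`-structure with finitely presented
  differentials and local coordinates, `1, …, μ − 1` units in the local rings, `S = V(H)` a regular
  hypersurface); `…_of_smooth` — on a scheme smooth over a perfect field of characteristic `p` with
  `p = 0 ∨ μ ≤ p`;
* `MarkedIdeal.not_idealOrder_coeff_comap_lt_of_le_factorial` — hence, in characteristic
  `p > 0` with **`p ≤ μ!`**, at every such point the next-level ideal has order `≥ p`: the tame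
  hypothesis "orders `< p`" under which the tree runs Kollár's maximal contact theorem
  (`KollarMaximalContactTame.lean`, `KollarGoingUpTame.lean`) FAILS for the next level at every point
  of `S ∩ supp(𝓘, μ)`, although it held for `(𝓘, μ)` itself as soon as `μ < p`. The honest
  threshold of the tame induction after one step is therefore `p > μ!`, not `p > μ`
  (`μ < p ≤ μ!` happens for every `μ ≥ 3`: `exists_prime_gt_le_factorial`, Bertrand; e.g. `μ = 3`,
  `p = 5`).

## Sources

* E. Bierstone, D. Grigoriev, P. Milman, J. Włodarczyk, arXiv:1206.3090 = Asian J. Math. 15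
  (2011): Def. 3.9.2, Lemma 3.9.4 (2), §4 Step 2, Thm. 8.0.4. [BierstoneGrigorievMilmanWlodarczyk2011]
* J. Kollár, *Lectures on Resolution of Singularities* (2007): §2.5 (p. 81), 3.104 Step 2.2,
  Cor. 3.85. [Kollar2007]
-/

noncomputable section

open CategoryTheory AlgebraicGeometry TopologicalSpace IsLocalRing

namespace Literature.AlgebraicGeometry.Resolution

universe u v

section Scheme

variable {k : Type v} [CommRing k] {X : Scheme.{u}} {φ : k →+* Γ(X, ⊤)} {H : X.IdealSheafData}

/-- **The restricted coefficient ideal has order `≥ μ!` over the cosupport** (BGMW Lemma 3.9.4 (2)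
read with the marking `μ!` of Def. 3.9.2): with hypotheses as in
`MarkedIdeal.support_coeff_comap_subschemeι` (finitely presented differentials, local coordinates,
`1, …, μ − 1` units in the local rings, `S = V(H)` a regular hypersurface), for every point `s` of
`S` over `supp(𝓘, μ)`: `μ! ≤ ord_s(𝒞(𝓘)·𝒪_S)`.
[cite: BierstoneGrigorievMilmanWlodarczyk2011, Lemma 3.9.4 (2), Def. 3.9.2] -/
theorem MarkedIdeal.factorial_le_idealOrder_coeff_comap (hX : HasFinitePresentationDifferentials φ)
    (hc : HasLocalCoordinates φ) (M : MarkedIdeal X)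
    (hunit : ∀ (x : X) (j : ℕ), 0 < j → j < M.mult → IsUnit (j : X.presheaf.stalk x))
    (hreg : ∀ x ∈ H.support, IsRegularLocalRing (X.presheaf.stalk x))
    (hH : ∀ x ∈ H.support, ∃ u : X.presheaf.stalk x,
      stalkIdeal H x = Ideal.span {u} ∧ u ∉ maximalIdeal (X.presheaf.stalk x) ^ 2)
    {s : H.subscheme} (hs : H.subschemeι s ∈ M.support) :
    (Nat.factorial M.mult : ℕ∞) ≤ idealOrder ((M.coeff φ).comap H.subschemeι).ideal s := by
  have hmem : s ∈ ((M.coeff φ).comap H.subschemeι).support := by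
    rw [M.support_coeff_comap_subschemeι hX hc hunit hreg hH]
    exact hs
  have hmult : ((M.coeff φ).comap H.subschemeι).mult = Nat.factorial M.mult := by
    rw [MarkedIdeal.comap_mult, MarkedIdeal.coeff_mult]
  rw [← hmult]
  exact hmem

end Scheme

section Smooth

variable (k : Type u) [Field k] (X : Scheme.{u}) [X.Over (Spec (.of k))]

/-- **On a scheme smooth over a perfect field of characteristic `p`** (or `0`), for `(X, 𝓘, E, μ)`
with `p = 0 ∨ μ ≤ p` and a regular hypersurface `S = V(H)` (order-one stalk generators): at every
point `s ∈ S` over `supp(𝓘, μ)`, `μ! ≤ ord_s(𝒞(𝓘)·𝒪_S)`.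
[cite: BierstoneGrigorievMilmanWlodarczyk2011, Lemma 3.9.4 (2) with Thm. 8.0.4] -/
theorem MarkedIdeal.factorial_le_idealOrder_coeff_comap_of_smooth (p : ℕ) [CharP k p] [PerfectField k]
    [Smooth (X ↘ Spec (.of k))] (M : MarkedIdeal X) (hμ : p = 0 ∨ M.mult ≤ p)
    {H : X.IdealSheafData} (hH : ∀ x ∈ H.support, ∃ u : X.presheaf.stalk x,
      stalkIdeal H x = Ideal.span {u} ∧ u ∉ maximalIdeal (X.presheaf.stalk x) ^ 2)
    {s : H.subscheme} (hs : H.subschemeι s ∈ M.support) :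
    (Nat.factorial M.mult : ℕ∞) ≤ idealOrder ((M.coeff (overHom k X)).comap H.subschemeι).ideal s := by
  have hmem : s ∈ ((M.coeff (overHom k X)).comap H.subschemeι).support := by
    rw [M.support_coeff_comap_subschemeι_of_smooth k X p hμ hH]
    exact hs
  have hmult : ((M.coeff (overHom k X)).comap H.subschemeι).mult = Nat.factorial M.mult := by
    rw [MarkedIdeal.comap_mult, MarkedIdeal.coeff_mult]
  rw [← hmult]
  exact hmem

/-- **The factorial threshold**: in characteristic `p > 0` with `μ ≤ p ≤ μ!` (e.g. `μ = 3, p = 5`),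
at every point of the regular hypersurface `S = V(H)` over `supp(𝓘, μ)` the next-level ideal
`𝒞(𝓘)·𝒪_S` has order `≥ p` — it is NOT in the tame range "order `< p`" under which the tree runs
the characteristic-zero maximal contact theorem (BGMW Thm. 8.0.4's proviso "as long as all
multiplicities stay `< p`"; Kollár §2.5: Abhyankar's threefolds in characteristic `> 3!`).
[cite: BierstoneGrigorievMilmanWlodarczyk2011, Thm. 8.0.4, Lemma 3.9.4 (2)] [cite: Kollar2007, §2.5 (p. 81)] -/
theorem MarkedIdeal.not_idealOrder_coeff_comap_lt_of_le_factorial (p : ℕ) [CharP k p]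
    [PerfectField k] [Smooth (X ↘ Spec (.of k))] (M : MarkedIdeal X) (hμp : M.mult ≤ p)
    (hp : p ≤ Nat.factorial M.mult) {H : X.IdealSheafData}
    (hH : ∀ x ∈ H.support, ∃ u : X.presheaf.stalk x,
      stalkIdeal H x = Ideal.span {u} ∧ u ∉ maximalIdeal (X.presheaf.stalk x) ^ 2)
    {s : H.subscheme} (hs : H.subschemeι s ∈ M.support) :
    ¬ idealOrder ((M.coeff (overHom k X)).comap H.subschemeι).ideal s < p := by
  have h := M.factorial_le_idealOrder_coeff_comap_of_smooth k X p (Or.inr hμp) hH hs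
  intro hlt
  have h' : (Nat.factorial M.mult : ℕ∞) < (p : ℕ∞) := lt_of_le_of_lt h hlt
  exact absurd (by exact_mod_cast h') (not_lt.mpr hp)

/-- **The factorial window is never empty**: for every order `μ ≥ 3` there is a prime `p` with
`μ < p ≤ μ!` (Bertrand: `μ < p ≤ 2μ ≤ μ!`) — a characteristic in which `(𝓘, μ)` is tame but its
first-level coefficient data are not (`not_idealOrder_coeff_comap_lt_of_le_factorial`); `μ = 3`
gives `p = 5`, and Abhyankar's bound for threefolds is `p > 3! = 6` (Kollár §2.5).
[cite: Kollar2007, §2.5 (p. 81)] -/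
theorem exists_prime_gt_le_factorial {μ : ℕ} (hμ : 3 ≤ μ) :
    ∃ p : ℕ, p.Prime ∧ μ < p ∧ p ≤ Nat.factorial μ := by
  obtain ⟨p, hp, hlt, hle⟩ := Nat.exists_prime_lt_and_le_two_mul μ (by omega)
  refine ⟨p, hp, hlt, hle.trans ?_⟩
  obtain ⟨n, rfl⟩ : ∃ n, μ = n + 1 := ⟨μ - 1, by omega⟩
  have h2 : 2 ≤ Nat.factorial n := by
    have h := Nat.factorial_le (show 2 ≤ n by omega)
    rwa [Nat.factorial_two] at h
  rw [Nat.factorial_succ, mul_comm 2 (n + 1)]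
  exact Nat.mul_le_mul_left (n + 1) h2

end Smooth

end Literature.AlgebraicGeometry.Resolution

end
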